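import Mathlib
import Summits.Ventures.PercRepro2.CoinCoreGate
import Summits.Ventures.PercRepro2.CoinOrTailKDefs
import Summits.Ventures.PercRepro2.CoinOrTailKSums
import Summits.Ventures.PercRepro2.CoinOrTailKCore
import Summits.Ventures.PercRepro2.CoinChainTower
import Summits.Ventures.PercRepro2.CoinTowerClose
import Summits.Ventures.PercRepro2.CoinTowerFunnel

/-!
# Both markers at two tower vertices: the DOUBLE funnel, over ANY core
(blind cell PercRepro2, night-2 g18; proofs/NIGHT2-DARC.md §58.13)

A SURE-coin OR-tower `low ++ v :: mid ++ [u]` over ANY closed-in core, then an OR-tower `up`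
and the free-arc vertex `a` with ANY coins; every route into `u` passes through `v` (the entries
of `mid` and of `u` lie outside `towerCore U low`) and every route into `a` passes through `u`
(the entries of `up` and of `a` lie outside `towerCore U (low ++ v :: mid)`).  Markers `(v, u)`:
after the reductions over `a`, `up` and the sure-coin closure of the lower structure, the markers
are `1[v ∈ cl W] ≥ 1[u ∈ cl W]` (`clSet_funnel` on the prefix, then `mem_clSet_iff`) and the gate
equals the `R`-law where `u` is not reached; `nested_functional_nonneg` closes:
**`darc_of_towerDoubleFunnel`**.
-/

namespace Summit.Ventures.PercRepro2.Coin

open Classical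

section DoubleFunnel

variable {V : Type*} {E : Type*} [Fintype V] [DecidableEq V] [Fintype E] [DecidableEq E]
  {R : Type*} [Field R] [LinearOrder R] [IsStrictOrderedRing R]
  {arcs : E → Finset (V × V)} {s : V} {U : Finset V} {ent entv entu : Finset V} {c cv cu : V → E}
  {a v u w : V} {low mid up : List (Finset V × (V → E) × V)}

omit [Fintype V] [Fintype E] [DecidableEq E] [Field R] [LinearOrder R] [IsStrictOrderedRing R] in
/-- The tower vertices of a list are not in the closure of a level unless inserted: a vertex that
is not a vertex of `L₂` is in `clSet (L₁ ++ L₂) W` iff it is in `clSet L₁ W`. -/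
lemma mem_clSet_append_iff (L₁ L₂ : List (Finset V × (V → E) × V)) (W : Finset V) {z : V}
    (hz : ∀ x ∈ L₂, z ≠ x.2.2) : z ∈ clSet (L₁ ++ L₂) W ↔ z ∈ clSet L₁ W := by
  rw [clSet_append]
  exact mem_clSet_iff L₂ _ hz

/-- **THEOREM (the DOUBLE funnel: markers at two tower vertices, ANY core).** -/
theorem darc_of_towerDoubleFunnel (pr : E → R) (hp : IsProbVec pr) (hS : SameEnds arcs)
    (hL : OrTower arcs s U low) (hsureL : ∀ x ∈ low, ∀ r ∈ x.1, pr (x.2.1 r) = 1)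
    (hv : OrTailK arcs s (towerCore U low) entv cv v) (hsurev : ∀ r ∈ entv, pr (cv r) = 1)
    (hM : OrTower arcs s (insert v (towerCore U low)) mid)
    (hsureM : ∀ x ∈ mid, ∀ r ∈ x.1, pr (x.2.1 r) = 1)
    (hu : OrTailK arcs s (towerCore (insert v (towerCore U low)) mid) entu cu u)
    (hsureu : ∀ r ∈ entu, pr (cu r) = 1)
    (hup : OrTower arcs s (insert u (towerCore (insert v (towerCore U low)) mid)) up)
    (h : OrTailK arcs s (towerCore (insert u (towerCore (insert v (towerCore U low)) mid)) up)
      ent c a)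
    (hcovM : ∀ x ∈ mid, ∀ r ∈ x.1, r ∉ towerCore U low) (hcovu : ∀ r ∈ entu, r ∉ towerCore U low)
    (hcovU : ∀ x ∈ up, ∀ r ∈ x.1, r ∉ towerCore (insert v (towerCore U low)) mid)
    (hcov : ∀ r ∈ ent, r ∉ towerCore (insert v (towerCore U low)) mid)
    {t : V} (htC : t ∉ insert a (towerCore (insert u (towerCore (insert v (towerCore U low)) mid))
      up)) (hts : t ≠ s) (hws : w ≠ s)
    (hwC : w ∉ insert a (towerCore (insert u (towerCore (insert v (towerCore U low)) mid)) up)) :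
    DARC pr arcs s {t} v u a w := by
  have hC := h.closedInCoreU
  -- the lower structure `low ++ v :: mid ++ [u]` over `U`, sure coins
  set L : List (Finset V × (V → E) × V) := (low ++ (entv, cv, v) :: mid) ++ [(entu, cu, u)]
    with hLdef
  have hcoreP : towerCore U (low ++ (entv, cv, v) :: mid) =
      towerCore (insert v (towerCore U low)) mid := by rw [towerCore_append]; rfl
  have hP : OrTower arcs s U (low ++ (entv, cv, v) :: mid) :=
    hL.append (OrTower.cons _ _ _ _ _ hv hM)
  have hLT : OrTower arcs s U L := by
    refine hP.append ?_
    rw [hcoreP]; exact OrTower.cons _ _ _ _ _ hu (OrTower.nil _)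
  have hcoreL : towerCore U L = insert u (towerCore (insert v (towerCore U low)) mid) := by
    simp only [hLdef]; rw [towerCore_append, hcoreP]; rfl
  have hsureAll : ∀ x ∈ L, ∀ r ∈ x.1, pr (x.2.1 r) = 1 := by
    intro x hx
    simp only [hLdef] at hx
    rcases List.mem_append.1 hx with hx | hx
    · rcases List.mem_append.1 hx with hx | hx
      · exact hsureL x hx
      · rw [List.mem_cons] at hx
        rcases hx with rfl | hx
        · exact hsurev
        · exact hsureM x hx
    · rw [List.mem_singleton] at hx; subst hx; exact hsureu
  -- memberships
  have hUL : towerCore (insert v (towerCore U low)) mid ⊆ towerCore U L := by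
    rw [hcoreL]; exact Finset.subset_insert _ _
  have huL : u ∈ towerCore U L := by rw [hcoreL]; exact Finset.mem_insert_self _ _
  have hvP : v ∈ towerCore (insert v (towerCore U low)) mid :=
    subset_towerCore _ mid (Finset.mem_insert_self _ _)
  have hvL : v ∈ towerCore U L := hUL hvP
  have hLC : towerCore U L ⊆ towerCore (towerCore U L) up := subset_towerCore _ up
  have haC' : a ∉ towerCore (insert u (towerCore (insert v (towerCore U low)) mid)) up := h.a_notin
  have hva : v ≠ a := fun e => haC' (e ▸ hcoreL ▸ hLC hvL)
  have hua : u ≠ a := fun e => haC' (e ▸ hcoreL ▸ hLC huL)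
  have hvert := hup.vertex_notin
  have hvv : ∀ x ∈ up, v ≠ x.2.2 := fun x hx e => hvert x hx (e ▸ hcoreL ▸ hvL)
  have huv : ∀ x ∈ up, u ≠ x.2.2 := fun x hx e => hvert x hx (e ▸ hcoreL ▸ huL)
  have huP : u ∉ towerCore (insert v (towerCore U low)) mid := hu.a_notin
  have hvC : v ∈ insert a (towerCore (insert u (towerCore (insert v (towerCore U low)) mid)) up) :=
    Finset.mem_insert_of_mem (hcoreL ▸ hLC hvL)
  have huC : u ∈ insert a (towerCore (insert u (towerCore (insert v (towerCore U low)) mid)) up) :=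
    Finset.mem_insert_of_mem (hcoreL ▸ hLC huL)
  have haC : a ∈ insert a (towerCore (insert u (towerCore (insert v (towerCore U low)) mid)) up) :=
    Finset.mem_insert_self _ _
  unfold DARC
  rw [hC.phiC_gate_eq pr hS htC hts hvC huC haC hws hwC]
  -- marker invariances under `insert a` and the upper vertices
  have hm1 : ∀ W : Finset V, (fun _ : Finset V => (1 : R)) (insert a W) = (fun _ => (1 : R)) W :=
    fun _ => rfl
  have hm1L : ∀ x ∈ up, ∀ W : Finset V, (fun _ : Finset V => (1 : R)) (insert x.2.2 W) =
    (fun _ => (1 : R)) W := fun _ _ _ => rfl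
  have hxa : ∀ W : Finset V, (fun W : Finset V => if v ∈ W then (1 : R) else 0) (insert a W) =
      (fun W : Finset V => if v ∈ W then (1 : R) else 0) W := by
    intro W; simp only [Finset.mem_insert, hva, false_or]
  have hxL : ∀ x ∈ up, ∀ W : Finset V,
      (fun W : Finset V => if v ∈ W then (1 : R) else 0) (insert x.2.2 W) =
      (fun W : Finset V => if v ∈ W then (1 : R) else 0) W := by
    intro x hx W; simp only [Finset.mem_insert, hvv x hx, false_or]
  have hya : ∀ W : Finset V, (fun W : Finset V => if u ∈ W then (1 : R) else 0) (insert a W) =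
      (fun W : Finset V => if u ∈ W then (1 : R) else 0) W := by
    intro W; simp only [Finset.mem_insert, hua, false_or]
  have hyL : ∀ x ∈ up, ∀ W : Finset V,
      (fun W : Finset V => if u ∈ W then (1 : R) else 0) (insert x.2.2 W) =
      (fun W : Finset V => if u ∈ W then (1 : R) else 0) W := by
    intro x hx W; simp only [Finset.mem_insert, huv x hx, false_or]
  have hxya : ∀ W : Finset V,
      (fun W : Finset V => (if v ∈ W then (1 : R) else 0) * (if u ∈ W then (1 : R) else 0))
        (insert a W) =
      (fun W : Finset V => (if v ∈ W then (1 : R) else 0) * (if u ∈ W then (1 : R) else 0)) W := by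
    intro W; simp only [Finset.mem_insert, hva, hua, false_or]
  have hxyL : ∀ x ∈ up, ∀ W : Finset V,
      (fun W : Finset V => (if v ∈ W then (1 : R) else 0) * (if u ∈ W then (1 : R) else 0))
        (insert x.2.2 W) =
      (fun W : Finset V => (if v ∈ W then (1 : R) else 0) * (if u ∈ W then (1 : R) else 0)) W := by
    intro x hx W; simp only [Finset.mem_insert, hvv x hx, huv x hx, false_or]
  -- the level reduction over `a`
  have eΛ := h.sum_R_eq pr t (fun _ => (1 : R)) hm1
  have eFa := h.sum_R_eq pr t (fun W => if v ∈ W then (1 : R) else 0) hxa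
  have eFb := h.sum_R_eq pr t (fun W => if u ∈ W then (1 : R) else 0) hya
  have eM := h.sum_G_eq (w := w) pr t (fun _ => (1 : R)) hm1
  have eX := h.sum_G_eq (w := w) pr t (fun W => if v ∈ W then (1 : R) else 0) hxa
  have eY := h.sum_G_eq (w := w) pr t (fun W => if u ∈ W then (1 : R) else 0) hya
  have eXY := h.sum_G_eq (w := w) pr t
    (fun W => (if v ∈ W then (1 : R) else 0) * (if u ∈ W then (1 : R) else 0)) hxya
  simp only [mul_one] at eΛ eM; rw [eΛ, eFa, eFb, eM, eX, eY, eXY]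
  set A : Finset V → R := fun X => prob pr (coreAvoidEvent arcs s t
    (insert a (towerCore (insert u (towerCore (insert v (towerCore U low)) mid)) up)) X) with hAdef
  obtain ⟨hA0, hAmono, hAlsm⟩ := OrTailU.head_props
    (U := towerCore (insert u (towerCore (insert v (towerCore U low)) mid)) up) (a := a) pr hp hS t
  have hp0 := hp.nonneg; have hp1 := hp.le_one
  set FR : Finset V → R := rValK A pr ent c a with hFR
  set FG : Finset V → R := gValK A pr ent c a w with hFG
  -- the upper tower
  have tΛ := hup.sum_tower pr FR (fun _ => (1 : R)) hm1L
  have tFa := hup.sum_tower pr FR (fun W => if v ∈ W then (1 : R) else 0) hxL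
  have tFb := hup.sum_tower pr FR (fun W => if u ∈ W then (1 : R) else 0) hyL
  have tM := hup.sum_tower pr FG (fun _ => (1 : R)) hm1L
  have tX := hup.sum_tower pr FG (fun W => if v ∈ W then (1 : R) else 0) hxL
  have tY := hup.sum_tower pr FG (fun W => if u ∈ W then (1 : R) else 0) hyL
  have tXY := hup.sum_tower pr FG
    (fun W => (if v ∈ W then (1 : R) else 0) * (if u ∈ W then (1 : R) else 0)) hxyL
  simp only [mul_one] at tΛ tM; rw [tΛ, tFa, tFb, tM, tX, tY, tXY, ← hcoreL]
  set TR : Finset V → R := towerVal pr up FR with hTR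
  set TG : Finset V → R := towerVal pr up FG with hTG
  -- the lower structure: the closure
  have assoc : ∀ (C : Finset V) (F m : Finset V → R),
      (∑ X ∈ C.powerset, prob pr (coreLevel arcs s C X) * F X * m X) =
        ∑ X ∈ C.powerset, prob pr (coreLevel arcs s C X) * (F X * m X) :=
    fun C F m => Finset.sum_congr rfl fun X _ => mul_assoc _ _ _
  rw [assoc _ TR (fun X => if v ∈ X then (1 : R) else 0),
    assoc _ TR (fun X => if u ∈ X then (1 : R) else 0),
    assoc _ TG (fun X => if v ∈ X then (1 : R) else 0),
    assoc _ TG (fun X => if u ∈ X then (1 : R) else 0),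
    assoc _ TG (fun X => (if v ∈ X then (1 : R) else 0) * (if u ∈ X then (1 : R) else 0))]
  have dΛ := hLT.sum_close pr hsureAll TR
  have dFa := hLT.sum_close pr hsureAll (fun X => TR X * (if v ∈ X then (1 : R) else 0))
  have dFb := hLT.sum_close pr hsureAll (fun X => TR X * (if u ∈ X then (1 : R) else 0))
  have dM := hLT.sum_close pr hsureAll TG
  have dX := hLT.sum_close pr hsureAll (fun X => TG X * (if v ∈ X then (1 : R) else 0))
  have dY := hLT.sum_close pr hsureAll (fun X => TG X * (if u ∈ X then (1 : R) else 0))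
  have dXY := hLT.sum_close pr hsureAll
    (fun X => TG X * ((if v ∈ X then (1 : R) else 0) * (if u ∈ X then (1 : R) else 0)))
  beta_reduce at dFa dFb dX dY dXY
  rw [dΛ, dFa, dFb, dM, dX, dY, dXY]
  have assoc' : ∀ (F m : Finset V → R),
      (∑ W ∈ U.powerset, prob pr (coreLevel arcs s U W) * (F (clSet L W) * m (clSet L W))) =
        ∑ W ∈ U.powerset, prob pr (coreLevel arcs s U W) * F (clSet L W) * m (clSet L W) :=
    fun F m => Finset.sum_congr rfl fun W _ => (mul_assoc _ _ _).symm
  rw [assoc' TR (fun X => if v ∈ X then (1 : R) else 0),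
    assoc' TR (fun X => if u ∈ X then (1 : R) else 0),
    assoc' TG (fun X => if v ∈ X then (1 : R) else 0),
    assoc' TG (fun X => if u ∈ X then (1 : R) else 0),
    assoc' TG (fun X => (if v ∈ X then (1 : R) else 0) * (if u ∈ X then (1 : R) else 0))]
  -- the nested-marker functional
  have hν0 : ∀ W, 0 ≤ prob pr (coreLevel arcs s U W) := fun W => prob_nonneg hp _
  have hFR0 : ∀ W, 0 ≤ FR W := fun W => rValK_nonneg hp0 hp1 hA0 ent c a W
  have hFG0 : ∀ W, 0 ≤ FG W := fun W => gValK_nonneg hp0 hp1 hA0 ent c a w W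
  have hFRlsm : ∀ s t : Finset V, FR s * FR t ≤ FR (s ∩ t) * FR (s ∪ t) := fun s t =>
    rValK_mul_le_all A pr ent c a hp0 hp1 hA0 hAlsm hAmono s t
  have hFGlsm : ∀ s t : Finset V, FG s * FG t ≤ FG (s ∩ t) * FG (s ∪ t) := fun s t =>
    gValK_mul_le_all A pr ent c a w hp0 hp1 hA0 hAlsm hAmono s t
  have hFRmono : ∀ s t : Finset V, s ⊆ t → FR t ≤ FR s := fun _ _ hst =>
    rValK_antitone hp0 hp1 hAmono ent c a hst
  have hFGmono : ∀ s t : Finset V, s ⊆ t → FG t ≤ FG s := fun _ _ hst =>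
    gValK_antitone hp0 hp1 hAmono ent c a w hst
  obtain ⟨hTR0, -, -⟩ := towerVal_props pr hp0 hp1 up FR hFR0 hFRlsm hFRmono
  obtain ⟨hTG0, -, -⟩ := towerVal_props pr hp0 hp1 up FG hFG0 hFGlsm hFGmono
  -- the closure facts
  have hclL : ∀ W ⊆ U, clSet L W ⊆ towerCore U L := fun W hW => clSet_subset_towerCore L U W hW
  have hfun : ∀ W ⊆ U, u ∈ clSet L W → v ∈ clSet L W := by
    intro W hW hu'
    have haU' : u ∉ insert v (towerCore U low) := fun hmem => huP (subset_towerCore _ mid hmem)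
    exact clSet_funnel (up := mid) (ent := entu) (c := cu) hcovM hcovu haU' hW hu'
  have hnou : ∀ W ⊆ U, u ∉ clSet L W → ∀ z, z ∈ clSet L W →
      z ∈ towerCore (insert v (towerCore U low)) mid := by
    intro W hW hu' z hz
    have := hclL W hW hz
    rw [hcoreL] at this
    rcases Finset.mem_insert.1 this with h' | h'
    · exact absurd (h' ▸ hz) hu'
    · exact h'
  refine nested_functional_nonneg U
    (fun W => prob pr (coreLevel arcs s U W) * TR (clSet L W))
    (fun W => prob pr (coreLevel arcs s U W) * TG (clSet L W))
    (fun W => if v ∈ clSet L W then (1 : R) else 0)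
    (fun W => if u ∈ clSet L W then (1 : R) else 0)
    (fun W => mul_nonneg (hν0 W) (hTR0 _)) (fun W => mul_nonneg (hν0 W) (hTG0 _))
    (fun W => by split_ifs <;> simp) (fun W => by split_ifs <;> simp) ?_ ?_
  · intro W hW
    have hWU : W ⊆ U := Finset.mem_powerset.1 hW
    by_cases hu' : u ∈ clSet L W
    · rw [if_pos hu', if_pos (hfun W hWU hu')]
    · rw [if_neg hu']; split_ifs <;> norm_num
  · intro W hW hy
    have hWU : W ⊆ U := Finset.mem_powerset.1 hW
    have hu' : u ∉ clSet L W := by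
      intro hmem
      rw [if_pos hmem] at hy
      exact one_ne_zero hy
    have hnoL : ∀ z ∈ up, ∀ r ∈ z.1, r ∉ clSet L W :=
      fun z hz r hr hrW => hcovU z hz r hr (hnou W hWU hu' r hrW)
    have hno : ∀ r ∈ ent, r ∉ clSet L W := fun r hr hrW => hcov r hr (hnou W hWU hu' r hrW)
    simp only [hTR, hTG]
    rw [towerVal_of_no_entry pr up FR hnoL, towerVal_of_no_entry pr up FG hnoL]
    simp only [hFR, hFG]
    rw [gValK_eq_rValK_of_no_entry A pr c a w hno]

end DoubleFunnel

end Summit.Ventures.PercRepro2.Coin
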